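import Mathlib
import HarnessLib
import HarnessLib.Audit
import Summits.CriticalPhenomena.Statement
import HarnessLib.Audit.Status.Attr

/-!
Route: MoebiusRestrictionCurrents

# Route MoebiusRestrictionCurrents — Möbius covariance of all critical 3D Ising correlations from
the two-point backbone restriction system

BACKBONE RESTRICTION SYSTEM (card moebius-restriction-currents, corrected). It suffices to show X =
DOMAIN MÖBIUS THEORY:
there are Δ > 0 and domain-indexed limits S^D_n such that, with the CANONICAL renormalisation ρ₀(δ)
= ⟨σ₀σ_{[e₁/δ]}⟩_{β_c}^{-1/2},
the free-b.c. critical correlations of the discretised domain D_δ = {z ∈ ℤ³ : cell of z meets D}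
satisfy ρ₀(δ)ⁿ⟨∏σ_{[xᵢ/δ]}⟩^free_{D_δ,β_c(3)}
→ S^D_n(x) locally uniformly on non-coincident x ∈ Dⁿ, for EVERY admissible open D ⊆ ℝ³ (open,
Lebesgue-null frontier; D = ℝ³ and
D = ℝ³∖{0} included and lattice-identical), S^{ℝ³}_2 > 0, and (D, x) ↦ S^D_n(x) is covariant with
weight ∏|φ′(xᵢ)|^{-Δ} under
translations, O(3), dilations and — for 0 ∉ D — the unit inversion ι (domain version of
Duminil-Copin ICM 2022 (8.2)). X is reached
through three cruxes: TwoPointDomainTheory (n = 2: existence, positivity, Euclid/scale),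
RemovalRatioInversion (n = 2: the ρ-free,
Δ-free inversion INVARIANCE of removal ratios ⟨σσ⟩_D/⟨σσ⟩_{ℝ³}), BackboneLift (2-point domain theory
⇒ all-n domain theory, the
continuum shadow of Aizenman's random-walk/backbone expansion); X plus the shared non-Gaussianity
crux (item 0636) and the support
FreeIsCritical give the conjunct with ρ = ρ₀ and S := S^{ℝ³} (0 off NonCoincident).
Lean: `let Adm : Set (EuclideanSpace ℝ (Fin 3)) → Prop := fun D => IsOpen D ∧ MeasureTheory.volume
(frontier D) = 0; let G := fun (D : Set (EuclideanSpace ℝ (Fin 3))) (δ : ℝ) (n : ℕ) (x : Fin n →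
EuclideanSpace ℝ (Fin 3)) => limUnder Filter.atTop (fun Lb : ℕ =>
Literature.Probability.LatticeModels.isingExpect (Literature.Probability.LatticeModels.zdGraph 3)
((Literature.Probability.LatticeModels.box 3 Lb).filter (fun z => z ∈
Literature.Probability.LatticeModels.latticeApprox δ '' D))
(Literature.Probability.LatticeModels.criticalBeta 3) 0
Literature.Probability.LatticeModels.BoundaryCondition.free
(Literature.Probability.LatticeModels.spinMonomial (fun i =>
Literature.Probability.LatticeModels.latticeApprox δ (x i)))); let ρ₀ := fun (δ : ℝ) => (Real.sqrt
(Literature.Probability.LatticeModels.criticalTwoPoint 3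
(Literature.Probability.LatticeModels.latticeApprox δ (EuclideanSpace.single (0 : Fin 3) (1 :
ℝ)))))⁻¹; let ι := EuclideanGeometry.inversion (0 : EuclideanSpace ℝ (Fin 3)) 1; ∃ (Δ : ℝ) (S : Set
(EuclideanSpace ℝ (Fin 3)) → Literature.Probability.LatticeModels.CorrFamily 3), 0 < Δ ∧ (∀ D : Set
(EuclideanSpace ℝ (Fin 3)), Adm D → ∀ n : ℕ, TendstoLocallyUniformlyOn (fun (δ : ℝ) (x : Fin n →
EuclideanSpace ℝ (Fin 3)) => ρ₀ δ ^ n * G D δ n x) (S D n) (nhdsWithin (0 : ℝ) (Set.Ioi 0))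
(Literature.Probability.LatticeModels.NonCoincident 3 n ∩ {x | ∀ i, x i ∈ D})) ∧ (∀ x ∈
Literature.Probability.LatticeModels.NonCoincident 3 2, 0 < S Set.univ 2 x) ∧ (∀ D : Set
(EuclideanSpace ℝ (Fin 3)), Adm D → ∀ (n : ℕ) (v : EuclideanSpace ℝ (Fin 3)) (x : Fin n →
EuclideanSpace ℝ (Fin 3)), (∀ i, x i ∈ D) → Function.Injective x → S ((fun z => z + v) '' D) n (fun
i => x i + v) = S D n x) ∧ (∀ D : Set (EuclideanSpace ℝ (Fin 3)), Adm D → ∀ (n : ℕ) (R :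
EuclideanSpace ℝ (Fin 3) ≃ₗᵢ[ℝ] EuclideanSpace ℝ (Fin 3)) (x : Fin n → EuclideanSpace ℝ (Fin 3)), (∀
i, x i ∈ D) → Function.Injective x → S (R '' D) n (fun i => R (x i)) = S D n x) ∧ (∀ D : Set
(EuclideanSpace ℝ (Fin 3)), Adm D → ∀ (n : ℕ) (c : ℝ), 0 < c → ∀ (x : Fin n → EuclideanSpace ℝ (Fin
3)), (∀ i, x i ∈ D) → Function.Injective x → S ((fun z => c • z) '' D) n (fun i => c • x i) = c ^
(-(n : ℝ) * Δ) * S D n x) ∧ (∀ D : Set (EuclideanSpace ℝ (Fin 3)), Adm D → (0 : EuclideanSpace ℝ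
(Fin 3)) ∉ D → ∀ (n : ℕ) (x : Fin n → EuclideanSpace ℝ (Fin 3)), (∀ i, x i ∈ D) → Function.Injective
x → S (ι '' D) n (fun i => ι (x i)) = (∏ i, ‖x i‖ ^ (2 * Δ)) * S D n x)`

## Assembly
CruxesGiveTarget composed with TargetSuffices: (A) TwoPointDomainTheory and (A′)
RemovalRatioInversion give the complete two-point
domain theory (existence, positivity, full Möbius covariance of H over admissible domains); (B)
BackboneLift lifts it to all n
(existence and covariance of every S^D_n); restricting to D = ℝ³ and D = ℝ³∖{0} (same lattice sets),
FreeIsCritical identifies the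
limits with those of criticalCorr 3 under ρ₀, and the shared crux supplies U₄ ≢ 0. Standard
reductions only: uniqueness of limits
along 𝓝[>]0, GKS box limits, the reflection mapping a unit vector to e₁, bookkeeping of the
covariance predicates of
ConformalCovariance.lean with S' = 0 off NonCoincident (the refutation mode of IsingEuclidUpgrade
0632/0637 is excluded by construction,
and the canonical ρ₀ excludes the killing-renormalisation mode of IsingCFTData 0663/0666).

Rationale: WHY THIS LINE. The card asks for Möbius covariance to be INHERITED from a random-geometric limit
object of the critical SOURCED random currents rather
than upgraded from scale covariance. Two corrections found while grounding it (NOTES.md MATH): (i)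
on the lattice the sourced cluster /
backbone obeys restriction WITH A DEFECT — M_G[C = S; S ∩ A = ∅] = M_{G∖A}[C =
S]·Z_{G∖S}Z_{G∖A}/(Z_{G∖(S∪A)}Z_G), the last factor
= e^{−𝓘} with 𝓘 ≥ 0 by GKS-II supermodularity (AizenmanCMP1982 Lemma 9.3 = in-tree
`ecurrentSum_koff_union_mul_ge`) — so the limit is a
restriction system with a loop-type defect functional, not an exact restriction family, and the
Brownian loop soup cannot be that
functional at any intensity (two far balls: Brownian loops give decay r^{-2(d−2)} = r^{-2}, the
Ising defect decays like r^{-2Δ_ε} ≈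
r^{-2.83}, BurkhardtEisenriegler1995 / small-sphere expansion); (ii) the card's undesigned F4 is
unnecessary: Aizenman's random-walk
(backbone) expansion ⟨σ_A⟩_Λ = Σ_j Σ_{ω: x₁→x_j} ρ_Λ(ω)⟨σ_{A∖{x₁,x_j}}⟩_{Λ, J≡0 on ω̃}
(AizenmanCMP1982 §9 Prop 9.2, eq. (9.8); PROVED in
tree: `Literature.Probability.LatticeModels.Current.tsum_sources_inCyl_eq`,
`…tsum_sources_forall_inCyl_eq`) closes a recursion on
TWO-POINT backbone measures 𝔅^D_{x,y} in punctured domains: S^D_n(x) = Σ_j ∫ S^{D∖k}_{n−2}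
d𝔅^D_{x₁→x_j}(k). Since the weights sit
only in the masses H_D(x,y) = S^D_2 and the normalised backbone LAWS should be Möbius INVARIANT
(transported), covariance of every
n-point function in every domain — hence of the full-space family — follows by induction from
two-point data; in d ≥ 4 the same
formula returns Wick's rule (backbone → Brownian motion, thin sets polar ⇒ S^{D∖k} = S^D), and in d
= 3 U₄ ≠ 0 exactly when the
backbone is felt (Aizenman's intersection criterion). Imported areas: conformal restriction /
loop-soup formalism
(LawlerSchrammWerner2003Restriction, LawlerWerner2004, SheffieldWerner2012; lattice dictionary
LupuWerner2016) transplanted to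
ℝ³∪{∞} with the 10-parameter Möbius group in place of conformal maps; classical potential theory
(Kelvin transform = h-transform
of 3D Brownian motion under inversion: the Δ = 1/2 instance of backbone covariance); boundary CFT
numerics as evidence
(CosmeLopesPenedones2015: ⟨σ⟩, ⟨σσ⟩ in a ball with free b.c. match conformal predictions;
MenesesEtAl2019; DengBlote2002). What no
prior route of this sub does: IsingEuclidUpgrade/IsingCFTData attack full-space covariance by
symmetry upgrade or CFT axioms,
PerfectScreening the two-point function only; none uses DOMAIN functionals, where restriction lives
and where inversion covariance
is a ρ-free, Δ-free lattice statement (RemovalRatioInversion) instead of a property of an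
unconstructed limit.

RANKED CRUXES. #0 Target (target) — X = DOMAIN MÖBIUS THEORY as in § Thesis: ∃ Δ > 0, ∃ S :
(domains) → CorrFamily 3 with (i) convergence of ρ₀ⁿ·(free critical n-point function of D_δ) to
S^D_n locally uniformly on non-coincident configurations in Dⁿ for every admissible open D, (ii)
S^{ℝ³}_2 > 0 off the diagonal, (iii) covariance of (D,x) ↦ S^D_n(x) under translations, O(3),
dilations (factor c^{-nΔ}) and, for 0 ∉ D, the unit inversion (factor ∏‖xᵢ‖^{2Δ}). (why it might
fail: Stronger than the conjunct (all domains, free b.c. must flow to ONE conformal boundary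
condition); already existence of the n=2 full-space limit and O(3) invariance are open on ℤ³ (ICM
2022 §8.4); a domain whose free surface orders differently would break (iii).) [DuminilCopinICM2022,
CosmeLopesPenedones2015, ChelkakHonglerIzyurov2015, AizenmanCMP1982]
#2 BackboneLift (crux) — BACKBONE LIFT (card F2–F4 made one statement): for every Δ > 0 and every
two-point domain kernel H with (a) ρ₀(δ)²⟨σ_{[x/δ]}σ_{[y/δ]}⟩^free_{D_δ} → H_D(x,y) locally
uniformly on x ≠ y in D for all admissible D, (b) H_{ℝ³} > 0 off the diagonal, (c)
translation/O(3)/dilation covariance and (d) inversion covariance H_{ιD}(ιx,ιy) =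
‖x‖^{2Δ}‖y‖^{2Δ}H_D(x,y) (0 ∉ D), there is a domain family S with ALL n-point limits existing in all
admissible domains, S^D_2 = H_D, and full domain Möbius covariance. Intended proof: tightness +
convergence of the rescaled backbone trace laws 𝔅^D_{x,y} (Aizenman's walk, any injective edge
ranking), passage to the limit in ⟨σ_A⟩ = Σ_j Σ_ω ρ(ω)⟨σ_{A∖1j}⟩_{off ω̃}, Möbius invariance of the
normalised backbone laws, induction on n. [difficulty: open-problem] (why it might fail: Needs
convergence AND Möbius invariance of the backbone trace LAW (a random fractal of unproved dimension)
— no tightness/identification tool in d=3 (no SLE); the limit may remember the edge ranking, or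
bond-removal may not act as a hard wall (transparency), breaking the continuum recursion.)
[AizenmanCMP1982, AizenmanDuminilCopinAnnals2021, DuminilcopinLisQian2025,
LawlerSchrammWerner2003Restriction, SheffieldWerner2012,
Literature.Probability.LatticeModels.Current.tsum_sources_inCyl_eq]
#3 RemovalRatioInversion (crux) — MÖBIUS-INVARIANT REMOVAL RATIOS (the restriction signature;
ρ-free, Δ-free, existence-free): for every admissible open D with 0 ∉ D and x ≠ y in D,
G^{ιD}_δ(ιx,ιy)/G^{ℝ³}_δ(ιx,ιy) − G^D_δ(x,y)/G^{ℝ³}_δ(x,y) → 0 as δ → 0⁺, where G^D_δ is the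
free-b.c. critical two-point function of the discretised domain and ι the unit inversion. In the
restriction dictionary the ratio is the defect-weighted avoidance functional E^{xy}[e^{−𝓘(K, Dᶜ)}; K
⊂ D] of the backbone/cluster, a conformally INVARIANT scalar; with TwoPointDomainTheory it is
equivalent to inversion covariance of H_D. [difficulty: open-problem] (why it might fail: Requires
the free lattice surface of EVERY admissible domain to renormalise to the same conformal
('ordinary') boundary condition with no residual scale; corners/cusps or slowly decaying surface
operators could leave O(1) non-invariant corrections; tested only for balls (Cosme et al. 2015).)
[CosmeLopesPenedones2015, BurkhardtEisenriegler1995, DuminilCopinICM2022, Cardy1996, DengBlote2002]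
#4 TwoPointDomainTheory (crux) — TWO-POINT DOMAIN THEORY (existence half, n = 2): ∃ Δ > 0 and H with
ρ₀(δ)²G^D_δ(x,y) → H_D(x,y) locally uniformly on x ≠ y ∈ D for every admissible open D (canonical
ρ₀, so H_{ℝ³}(0,e₁) = 1), H_{ℝ³} > 0 off the diagonal, and covariance of (D,x,y) ↦ H_D(x,y) under
translations, O(3) and dilations (factor c^{-2Δ}). The full-space part is 'η exists, isotropic pure
power law' in canonical units; the domain part is existence of the boundary two-point functions.
[difficulty: open-problem] (why it might fail: Existence of lim ρ₀(δ)²⟨σ₀σ_x⟩ even in full space is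
open (η(3) not known to exist: DC–Panis: η ≤ 1/2 IF it exists; only c|x|⁻² ≤ G ≤ C|x|⁻¹); O(3)
invariance has no mechanism; domains add boundary exponents with even less control.)
[DuminilCopinICM2022, DuminilCopinPanis2025LowerBounds, AizenmanDuminilCopinAnnals2021,
CosmeLopesPenedones2015, Literature.Probability.LatticeModels.criticalTwoPoint_bounds]
#5 IsingEuclidUpgradeR4NonGaussian (crux) — SHARED non-Gaussianity crux (item
stmt-CriticalPhenomena-0636 of routes IsingEuclidUpgrade/IsingCFTData, re-wanted verbatim): every
non-degenerate pointwise scaling limit of the renormalised critical correlators on ℤ³ has U₄ ≢ 0. In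
this route's picture U₄ = Σ_j H(x₁,x_j)(E^{1j}[H_{ℝ³∖k}(x_k,x_l)] − H(x_k,x_l)) ≤ 0, nonzero iff the
backbone of one pair is felt by the other (Aizenman's intersection criterion; the card's heuristic:
two-point mass exponent 3 − 2Δ_σ ≈ 1.96 > 3/2 for each sourced cluster). [difficulty: open-problem]
(why it might fail: No lower bound on macroscopic intersection/avoidance of two critical backbones
on ℤ³ is known; for d ≥ 4 (and RP long-range α<3/2 on ℤ³) every such limit IS Gaussian, so the proof
must use n.n. d=3 input.) [AizenmanCMP1982, AizenmanDuminilCopinAnnals2021,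
Literature.Barriers.CriticalPhenomena.IsingTrivialityFromDimensionFour,
Literature.Barriers.CriticalPhenomena.LongRangeTrivialityOnZ3]
#9 FreeIsCritical (support) — At β_c(3) the free-boundary box limit of every spin monomial exists
and equals the critical (plus-state) correlator: ⟨∏σ_{yᵢ}⟩^free_{box L, β_c} → criticalCorr 3 n y.
GKS-II monotone limit plus uniqueness of the Gibbs measure at β_c(3) (in tree:
hasUniqueGibbsMeasure_criticalBeta_holds, hasBoxLimit_isingCorr_free, exists_freeMeasure_holds).
Used by the assembly to identify the D = ℝ³ member of the domain family with criticalCorr.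
[difficulty: provable-now] [FriedliVelenik2017, AizenmanDuminilCopinSidoravicius2015,
Literature.Probability.LatticeModels.hasUniqueGibbsMeasure_criticalBeta_holds]
#9 CasimirInversion (support) — LOOP-DEFECT (CASIMIR) FUNCTIONAL IS MÖBIUS INVARIANT (n = 0 level of
the restriction system; the corrected 'loop soup'): for a bounded admissible cavity D with 0 ∉ D̄
and disjoint closed balls A, B ⊂ D, the interaction free energy 𝓘_δ(D;A,B) = log[Z_D
Z_{D∖(A∪B)}/(Z_{D∖A}Z_{D∖B})] (free b.c., β_c(3); ≥ 0 by GKS-II; all bulk/surface/edge terms cancel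
exactly) satisfies 𝓘_δ(D;A,B) − 𝓘_δ(ιD;ιA,ιB) → 0. Burkhardt–Eisenriegler's hypothesis made a
lattice statement; decay in the separation r of two small balls ∝ r^{-2Δ_ε}, which is what rules out
the Brownian loop measure (∝ r^{-2}) as the defect functional. [difficulty: open-problem]
[BurkhardtEisenriegler1995, AizenmanCMP1982, LawlerWerner2004, Cardy1996]
#9 CruxesGiveTarget (support) — Glue: TwoPointDomainTheory → RemovalRatioInversion → BackboneLift →
Target. From (A) get Δ, H; RemovalRatioInversion and the convergences give
H_{ιD}(ιx,ιy)/H_{ℝ³}(ιx,ιy) = H_D(x,y)/H_{ℝ³}(x,y); Euclid+scale covariance gives H_{ℝ³}(x,y) =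
C‖x−y‖^{-2Δ} (reflection taking (y−x)/‖y−x‖ to e₁), hence H_{ℝ³}(ιx,ιy) =
‖x‖^{2Δ}‖y‖^{2Δ}H_{ℝ³}(x,y) and inversion covariance of H_D; feed BackboneLift; positivity of
S^{ℝ³}_2 from S_2 = H (plumbing checked in planner TestGlue.lean). [difficulty: M]
[FrancescoMathieuSenechal1997, DuminilCopinICM2022]
#9 TargetSuffices (support) — Glue: Target → IsingEuclidUpgradeR4NonGaussian → FreeIsCritical →
Ising3DConformalLimit. Take ρ = ρ₀ (positive on (0,1] by criticalTwoPoint > 0), Δ, S' := S^{ℝ³}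
extended by 0 off NonCoincident; FreeIsCritical + surjectivity of latticeApprox δ (δ > 0) turn the D
= univ convergence into HasPointwiseScalingLimit (criticalCorr 3) ρ₀ S'; non-degeneracy from (ii);
Euclid/scale covariance from (iii) with D = univ (images = univ); inversion covariance from (iii)
with D = {0}ᶜ, whose discretisation equals that of univ (latticeApprox δ '' {0}ᶜ = univ), plus
uniqueness of locally uniform limits; U₄ from the shared crux. [difficulty: M] [DuminilCopinICM2022,
ChelkakHonglerIzyurov2015]

TWO-LAYER PLAN. Foreseen glued splits (k ≤ 3, depth 1), filed only after a crux closes or is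
stamped: BackboneLift ⇐ BackboneTightness (subsequential
limits of rescaled backbone trace laws in (NonemptyCompacts ℝ³, Hausdorff), uniformly non-degenerate
avoidance of macroscopic balls) →
BackboneRecursionLimit (Aizenman's identity passes to the limit: bond removal acts as a hard wall, k
↦ H_{D∖k} continuous along the
limit) → BackboneLawInvariance (normalised limit laws are transported by the Möbius generators;
candidate mechanism: characterisation
of the limit law by restriction-with-defect + two-sided domain Markov property + reversibility, the
3D substitute for SLE
identification; Kelvin-covariant h-transformed Brownian paths are the Δ = 1/2 solution) →
BackboneLift. TwoPointDomainTheory ⇐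
FullSpaceTwoPoint (η exists, isotropy; shared with IsingEuclidUpgrade r2/r3) → BoundaryTwoPoint
(domains) → TwoPointDomainTheory.
RemovalRatioInversion ⇐ ball/half-space/shell special cases first (support), then general admissible
D.

KILL CRITERIA. (a) A Monte-Carlo or rigorous violation of RemovalRatioInversion in ONE geometry
(half-space {x₃>0} with x=(0,0,1), y=(0,0,3) versus
(0,0,1),(0,0,1/3); or ball ↔ exterior-of-ball) beyond corrections to scaling refutes r3 and CLOSES
the route (domain conformal
invariance is the whole bet; the conjunct itself would survive only through other routes). (b) A
proof that rescaled backbone trace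
laws on ℤ³ have ranking-dependent or non-Möbius-invariant subsequential limits while two-point
functions stay covariant refutes the
MECHANISM of r2: pivot r2 to the ranking-free sourced-CLUSTER system (restriction with defect +
explicit 4-connected term) or close
`refuted:BackboneLift`. (c) ¬IsingEuclidUpgradeR4NonGaussian (a Gaussian non-degenerate limit, item
0645) refutes the conjunct for
everyone. (d) If TwoPointDomainTheory is proved WITHOUT domains elsewhere (IsingEuclidUpgrade
r2+r3+r6) nothing is mooted: r3 and r2
remain this route's content; if full Möbius covariance is proved elsewhere the route closes
`superseded`.

NOT DECOMPOSED YET. Tightness of backbone laws and the a-priori 'macroscopic avoidance probabilities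
in (0,1)' estimate (card F2; quasi-multiplicativity on
ℤ³, open); the hard-wall lemma (bond removal vs sausage removal); the characterisation conjecture
for restriction-with-defect path laws
(card F3) and any use of Brownian excursions/loop measures beyond the Δ = 1/2 consistency check; the
n-point induction bookkeeping
(measurability on the hyperspace of compacts); boundary-operator content of the free surface (why
admissible domains suffice); the
negative items ¬RemovalRatioInversion / ranking-dependence. All are layer-2 children or support
lemmas (`--supports BackboneLift`).

CHEAPEST FALSIFIER. RemovalRatioInversion in the half-space: Wolff-cluster MC of the n.n. model at
β_c = 0.221654626 on L×L×L/2 slabs with one free face,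
δ = 1/8…1/48, comparing r_δ(x,y) = ⟨σ_xσ_y⟩_{ℍ}/⟨σ_xσ_y⟩_{ℝ³} at (0,0,1),(0,0,3) and at
(0,0,1),(0,0,1/3) (same conformal invariant
ξ = |x−y|²/(4x₃y₃) = 1/3): the difference must extrapolate to 0. Not run here (hub is compute-free
for planners' MC; a refuter can `kit
compute submit` it). The ball version has effectively been run: CosmeLopesPenedones2015 find ⟨σ⟩ and
⟨σσ⟩ in a ball with free b.c.
consistent with the conformal (ball ≅ half-space by a Möbius map) predictions within MC errors.

NUMBERS. Δ_σ = 0.518151(6), Δ_ε = 1.41264(6) (bootstrap, quoted in CosmeLopesPenedones2015 §2);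
β_c(3) = 0.221654626(5); rigorous window
c|x|⁻² ≤ ⟨σ₀σ_x⟩_{β_c} ≤ C|x|⁻¹ (criticalTwoPoint_bounds); two-point mass exponent of a sourced
cluster 3 − 2Δ_σ ≈ 1.96
(heuristic); expected decay of the two-ball defect 𝓘 ∝ r^{-2Δ_ε} ≈ r^{-2.83} vs Brownian-loop
r^{-2}. Items at open: 10.

DEFINITION REQUESTS. `brownianBridgeTraceLaw3` (law of the range of Brownian motion in ℝ³ from x
h-transformed by |·−y|⁻¹, run until it hits y; topic
Literature/Probability/Process, building on BrownianVec/NewtonPotential) — wanted for a support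
statement KelvinBridgeCovariance
(ι_* law(x→y) = law(ιx→ιy): the Δ = 1/2 instance of BackboneLawInvariance), to be filed
informal-only after open. No cite facts needed:
every signature above uses definitions only (isingExpect, isingPartitionFunction, criticalBeta,
criticalTwoPoint, criticalCorr, box,
latticeApprox, NonCoincident, CorrFamily, EuclideanGeometry.inversion), so the import cone adds no
unproved named fact.

Novelty: Searches (2026-08-15; openalex/s2/arxiv APIs rate-limited this session, crossref + local hybrid
used): `lit search --source crossref
"conformal invariance of double random currents"` (1 relevant: doi:10.1112/plms.70022), `"random
current backbone Ising scaling limit"` (0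
relevant), `"Kelvin transform Brownian motion inversion h-transform"` (0 relevant), `"Casimir
interaction of spheres in a fluid at the
critical point"` (BurkhardtEisenriegler1995), `"conformal restriction measures higher dimensions
Brownian"` (only 2D: Wu 2015 survey,
Cai–Gao 2026), `"Conformal symmetry of the critical 3D Ising model inside a sphere"`
(CosmeLopesPenedones2015, read §1–2);
`lit search --hybrid` ×3 (holdings: Lawler 2005, Di Francesco et al., Cardy 1996 — planar/CFT only);
`lit frontier CriticalPhenomena
--since 2021` (30 rows; loop-soup/CLE items planar; arXiv:2604.05772 read p.1: 3D geometric clusters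
MC, no currents); `lit bridges
--cross any`; the card's own audit (refuter-novelty-audit-3-0: LSW 2003, Lupu–Werner 2016, Werner
2016/2020 read).
Nearest prior art found: DuminilcopinLisQian2025 (conformal invariance of DOUBLE random currents,
planar, via dimers/discrete
holomorphicity); AizenmanCMP1982 §9 (the backbone expansion, used for Gaussian bounds, never for
covariance); LawlerSchrammWerner2003Restriction
+ SheffieldWerner2012 (planar restriction/loop-soup constructions); CosmeLopesPenedones2015 /
BurkhardtEisenriegler1995 (physics use of
d = 3 Möbius maps for free-b.c. balls and Casimir  [refs: 10.1112/plms.70022, 2604.05772, doi:10.1112/plms.70022, BurkhardtEisenriegler1995, CosmeLopesPenedones2015, DuminilcopinLisQian2025, AizenmanCMP1982, SheffieldWerner2012]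

Barriers (technique_class: conformal-restriction-3d, random-currents, backbone): - technique_class: conformal-restriction-3d, random-currents, backbone
- Literature.Barriers.CriticalPhenomena.LiouvilleRigidity: evaded by design — no domain is ever
mapped to a reference domain; only nested domains (restriction) and the Möbius generators acting on
(D, x) are used, which is exactly what survives Liouville in d = 3; the price is that
RemovalRatioInversion/BackboneLift must hold for ALL admissible domains, not for one uniformised
one.
- Literature.Barriers.CriticalPhenomena.ScaleCovarianceNotMoebius: not engaged — inversion
covariance is never deduced from scale covariance; the extra input is geometric (Möbius invariance
of removal ratios and of backbone laws), and the barrier's witness family has no domain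
structure/restriction system at all.
- Literature.Barriers.CriticalPhenomena.IsingTrivialityFromDimensionFour: consistent, not uniform —
the backbone recursion is dimension-free and returns Wick's rule when thin sets are polar (d ≥ 4);
non-Gaussianity enters only through the shared d = 3 crux 0636 (backbone felt with positive
probability).
- Literature.Barriers.CriticalPhenomena.TransverseCrossingsNeedNotMeet: relevant only to the U₄ crux
(intersection of two backbones is metric, not topological, in d = 3); this route adds nothing there
and says so.
- Literature.Barriers.CriticalPhenomena.BootstrapLatticeBlindness: not engaged — every item is a
statement about the lattice family criticalCorr / free-b.c. domain correlations; bootstrap numbers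
(Δ_σ, Δ_ε) appe

Novelty grade: new-combination — ROUTE REVIEW (refuter): keep open. Conforming (Assembly → _root_.Ising3DConformalLimit); 10/10 elaborate; junk domains of Adm (∅, co-null, ℝ³∖axis) reduce to full-space clauses, no cheap cex; limUnder/⨆ not junk (GKS monotone; Z eventually constant); glue 4859/4860 routine; FreeIsCritical provable n (refuter refuter-rreview-route-CriticalPhenomena--6f630ba7-0, 2026-08-15T13:52:33Z; prior: AizenmanCMP1982 §9; DuminilcopinLisQian2025; LawlerSchrammWerner2003Restriction; CosmeLopesPenedones2015)

sub-problem: Ising3DConformalLimit · status: open · opened planner-plancard-CriticalPhenomena-Ising3DCon-d8e4d4fd-0 2026-08-15T11:35:21Z · rev 3 · ledger route-CriticalPhenomena-MoebiusRestrictionCurrents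
GENERATED by the gate from the ledger (D-0016/17). Provers cite these decls: `theorem foo : Summit.CriticalPhenomena.Ising3DConformalLimit.Theses.MoebiusRestrictionCurrents.<Decl> := …` in Summits/CriticalPhenomena/Ising3DConformalLimit/Theorems/<Name>.lean.
-/

namespace Summit.CriticalPhenomena.Ising3DConformalLimit.Theses.MoebiusRestrictionCurrents

open scoped BigOperators Topology Manifold Classical MeasureTheory ProbabilityTheory Matrix InnerProductSpace ComplexConjugate ContinuousMap
open Filter Set Function TopologicalSpace MeasureTheory

attribute [summit_statement] _root_.Ising3DConformalLimit

/-- item stmt-CriticalPhenomena-4853 · target · rank 0 · open · by planner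
why it might fail: Strictly stronger than the conjunct: free-b.c. limits must exist in EVERY admissible domain and flow to ONE conformally (not merely scale-) invariant b.c.; already the full-space pieces (η(3) exists, O(3) invariance) are open (arXiv:2208.00864 §8.4); boundary scale ⇏ conformal (1210.6439).
sources: DuminilCopinICM2022, ChelkakHonglerIzyurov2021, CosmeLopesPenedones2015, arXiv:1210.6439, AizenmanCMP1982
[target] X = DOMAIN MÖBIUS THEORY as in § Thesis: ∃ Δ > 0, ∃ S : (domains) → CorrFamily 3 with (i)
convergence of ρ₀ⁿ·(free critical n-point function of D_δ) to S^D_n locally uniformly on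
non-coincident configurations in Dⁿ for every admissible open D, (ii) S^{ℝ³}_2 > 0 off the diagonal,
(iii) covariance of (D,x) ↦ S^D_n(x) under translations, O(3), dilations (factor c^{-nΔ}) and, for 0
∉ D, the unit inversion (factor ∏‖xᵢ‖^{2Δ}). -/
@[route_item "route-CriticalPhenomena-MoebiusRestrictionCurrents"]
def Target : Prop :=
  let Adm : Set (EuclideanSpace ℝ (Fin 3)) → Prop := fun D => IsOpen D ∧ MeasureTheory.volume (frontier D) = 0; let G := fun (D : Set (EuclideanSpace ℝ (Fin 3))) (δ : ℝ) (n : ℕ) (x : Fin n → EuclideanSpace ℝ (Fin 3)) => limUnder Filter.atTop (fun Lb : ℕ => Literature.Probability.LatticeModels.isingExpect (Literature.Probability.LatticeModels.zdGraph 3) ((Literature.Probability.LatticeModels.box 3 Lb).filter (fun z => z ∈ Literature.Probability.LatticeModels.latticeApprox δ '' D)) (Literature.Probability.LatticeModels.criticalBeta 3) 0 Literature.Probability.LatticeModels.BoundaryCondition.free (Literature.Probability.LatticeModels.spinMonomial (fun i => Literature.Probability.LatticeModels.latticeApprox δ (x i)))); let ρ₀ := fun (δ : ℝ) => (Real.sqrt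 (Literature.Probability.LatticeModels.criticalTwoPoint 3 (Literature.Probability.LatticeModels.latticeApprox δ (EuclideanSpace.single (0 : Fin 3) (1 : ℝ)))))⁻¹; let ι := EuclideanGeometry.inversion (0 : EuclideanSpace ℝ (Fin 3)) 1; ∃ (Δ : ℝ) (S : Set (EuclideanSpace ℝ (Fin 3)) → Literature.Probability.LatticeModels.CorrFamily 3), 0 < Δ ∧ (∀ D : Set (EuclideanSpace ℝ (Fin 3)), Adm D → ∀ n : ℕ, TendstoLocallyUniformlyOn (fun (δ : ℝ) (x : Fin n → EuclideanSpace ℝ (Fin 3)) => ρ₀ δ ^ n * G D δ n x) (S D n) (nhdsWithin (0 : ℝ) (Set.Ioi 0)) (Literature.Probability.LatticeModels.NonCoincident 3 n ∩ {x | ∀ i, x i ∈ D})) ∧ (∀ x ∈ Literature.Probability.LatticeModels.NonCoincident 3 2, 0 < S Set.univ 2 x) ∧ (∀ D : Set (EuclideanSpace ℝ (Fin 3)), Adm D → ∀ (n : ℕ) (v : EuclideanSpace ℝ (Fin 3)) (x : Fin n → EuclideanSpace ℝ (Fin 3)), (∀ i, x i ∈ D) → Function.Injective x → S ((fun z =>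 z + v) '' D) n (fun i => x i + v) = S D n x) ∧ (∀ D : Set (EuclideanSpace ℝ (Fin 3)), Adm D → ∀ (n : ℕ) (R : EuclideanSpace ℝ (Fin 3) ≃ₗᵢ[ℝ] EuclideanSpace ℝ (Fin 3)) (x : Fin n → EuclideanSpace ℝ (Fin 3)), (∀ i, x i ∈ D) → Function.Injective x → S (R '' D) n (fun i => R (x i)) = S D n x) ∧ (∀ D : Set (EuclideanSpace ℝ (Fin 3)), Adm D → ∀ (n : ℕ) (c : ℝ), 0 < c → ∀ (x : Fin n → EuclideanSpace ℝ (Fin 3)), (∀ i, x i ∈ D) → Function.Injective x → S ((fun z => c • z) '' D) n (fun i => c • x i) = c ^ (-(n : ℝ) * Δ) * S D n x) ∧ (∀ D : Set (EuclideanSpace ℝ (Fin 3)), Adm D → (0 : EuclideanSpace ℝ (Fin 3)) ∉ D → ∀ (n : ℕ) (x : Fin n → EuclideanSpace ℝ (Fin 3)), (∀ i, x i ∈ D) → Function.Injective x → S (ι '' D) n (fun i => ι (x i)) = (∏ i, ‖x i‖ ^ (2 * Δ)) * S D n x)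

/-- item stmt-CriticalPhenomena-4854 · crux · rank 2 · open · by planner
why it might fail: 2-point Möbius data do not formally give n-point existence/covariance (ScaleCovarianceNotMoebiusNarrow: S₂ = ‖x−y‖^{-2Δ} yet non-Möbius S₄, all Δ > 0); the backbone-law limit needs tightness + identification of a random fractal on ℤ³ (no SLE analogue) and a hard-wall limit of bond removal.
sources: AizenmanCMP1982, AizenmanBurchardDuke1999, Literature.Barriers.CriticalPhenomena.ScaleCovarianceNotMoebiusNarrow, Literature.Probability.LatticeModels.tsum_sources_inCyl_eq, DuminilcopinLisQian2025, LawlerSchrammWerner2003Restriction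
[crux] BACKBONE LIFT (card F2–F4 made one statement): for every Δ > 0 and every two-point domain
kernel H with (a) ρ₀(δ)²⟨σ_{[x/δ]}σ_{[y/δ]}⟩^free_{D_δ} → H_D(x,y) locally uniformly on x ≠ y in D
for all admissible D, (b) H_{ℝ³} > 0 off the diagonal, (c) translation/O(3)/dilation covariance and
(d) inversion covariance H_{ιD}(ιx,ιy) = ‖x‖^{2Δ}‖y‖^{2Δ}H_D(x,y) (0 ∉ D), there is a domain family
S with ALL n-point limits existing in all admissible domains, S^D_2 = H_D, and full domain Möbius
covariance. Intended proof: tightness + convergence of the rescaled backbone trace laws 𝔅^D_{x,y}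
(Aizenman's walk, any injective edge ranking), passage to the limit in ⟨σ_A⟩ = Σ_j Σ_ω
ρ(ω)⟨σ_{A∖1j}⟩_{off ω̃}, Möbius invariance of the normalised backbone laws, induction on n.
[difficulty: open-problem] -/
@[route_item "route-CriticalPhenomena-MoebiusRestrictionCurrents", crux]
def BackboneLift : Prop :=
  let Adm : Set (EuclideanSpace ℝ (Fin 3)) → Prop := fun D => IsOpen D ∧ MeasureTheory.volume (frontier D) = 0; let G := fun (D : Set (EuclideanSpace ℝ (Fin 3))) (δ : ℝ) (n : ℕ) (x : Fin n → EuclideanSpace ℝ (Fin 3)) => limUnder Filter.atTop (fun Lb : ℕ => Literature.Probability.LatticeModels.isingExpect (Literature.Probability.LatticeModels.zdGraph 3) ((Literature.Probability.LatticeModels.box 3 Lb).filter (fun z => z ∈ Literature.Probability.LatticeModels.latticeApprox δ '' D)) (Literature.Probability.LatticeModels.criticalBeta 3) 0 Literature.Probability.LatticeModels.BoundaryCondition.free (Literature.Probability.LatticeModels.spinMonomial (fun i => Literature.Probability.LatticeModels.latticeApprox δ (x i)))); let ρ₀ := fun (δ : ℝ) => (Real.sqrt (Literature.Probability.LatticeModels.criticalTwoPoint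 3 (Literature.Probability.LatticeModels.latticeApprox δ (EuclideanSpace.single (0 : Fin 3) (1 : ℝ)))))⁻¹; let ι := EuclideanGeometry.inversion (0 : EuclideanSpace ℝ (Fin 3)) 1; ∀ (Δ : ℝ) (H : Set (EuclideanSpace ℝ (Fin 3)) → EuclideanSpace ℝ (Fin 3) → EuclideanSpace ℝ (Fin 3) → ℝ), 0 < Δ → (∀ D : Set (EuclideanSpace ℝ (Fin 3)), Adm D → TendstoLocallyUniformlyOn (fun (δ : ℝ) (x : Fin 2 → EuclideanSpace ℝ (Fin 3)) => ρ₀ δ ^ 2 * G D δ 2 x) (fun x => H D (x 0) (x 1)) (nhdsWithin (0 : ℝ) (Set.Ioi 0)) (Literature.Probability.LatticeModels.NonCoincident 3 2 ∩ {x | ∀ i, x i ∈ D})) → (∀ x y : EuclideanSpace ℝ (Fin 3), x ≠ y → 0 < H Set.univ x y) → (∀ D : Set (EuclideanSpace ℝ (Fin 3)), Adm D → ∀ (v x y : EuclideanSpace ℝ (Fin 3)), x ∈ D → y ∈ D → x ≠ y → H ((fun z => z + v) '' D) (x + v) (y + v) = H D x y) ∧ (∀ D : Set (EuclideanSpace ℝ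 (Fin 3)), Adm D → ∀ (R : EuclideanSpace ℝ (Fin 3) ≃ₗᵢ[ℝ] EuclideanSpace ℝ (Fin 3)) (x y : EuclideanSpace ℝ (Fin 3)), x ∈ D → y ∈ D → x ≠ y → H (R '' D) (R x) (R y) = H D x y) ∧ (∀ D : Set (EuclideanSpace ℝ (Fin 3)), Adm D → ∀ (c : ℝ), 0 < c → ∀ (x y : EuclideanSpace ℝ (Fin 3)), x ∈ D → y ∈ D → x ≠ y → H ((fun z => c • z) '' D) (c • x) (c • y) = c ^ (-(2 : ℝ) * Δ) * H D x y) → (∀ D : Set (EuclideanSpace ℝ (Fin 3)), Adm D → (0 : EuclideanSpace ℝ (Fin 3)) ∉ D → ∀ (x y : EuclideanSpace ℝ (Fin 3)), x ∈ D → y ∈ D → x ≠ y → H (ι '' D) (ι x) (ι y) = ‖x‖ ^ (2 * Δ) * ‖y‖ ^ (2 * Δ) * H D x y) → ∃ S : Set (EuclideanSpace ℝ (Fin 3)) → Literature.Probability.LatticeModels.CorrFamily 3, (∀ D : Set (EuclideanSpace ℝ (Fin 3)), Adm D → ∀ n : ℕ, TendstoLocallyUniformlyOn (fun (δ : ℝ)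 (x : Fin n → EuclideanSpace ℝ (Fin 3)) => ρ₀ δ ^ n * G D δ n x) (S D n) (nhdsWithin (0 : ℝ) (Set.Ioi 0)) (Literature.Probability.LatticeModels.NonCoincident 3 n ∩ {x | ∀ i, x i ∈ D})) ∧ (∀ D : Set (EuclideanSpace ℝ (Fin 3)), Adm D → ∀ x y : EuclideanSpace ℝ (Fin 3), x ∈ D → y ∈ D → x ≠ y → S D 2 ![x, y] = H D x y) ∧ (∀ D : Set (EuclideanSpace ℝ (Fin 3)), Adm D → ∀ (n : ℕ) (v : EuclideanSpace ℝ (Fin 3)) (x : Fin n → EuclideanSpace ℝ (Fin 3)), (∀ i, x i ∈ D) → Function.Injective x → S ((fun z => z + v) '' D) n (fun i => x i + v) = S D n x) ∧ (∀ D : Set (EuclideanSpace ℝ (Fin 3)), Adm D → ∀ (n : ℕ) (R : EuclideanSpace ℝ (Fin 3) ≃ₗᵢ[ℝ] EuclideanSpace ℝ (Fin 3)) (x : Fin n → EuclideanSpace ℝ (Fin 3)), (∀ i, x i ∈ D) → Function.Injective x → S (R '' D) n (fun i => R (x i)) = S D n x) ∧ (∀ D : Set (EuclideanSpace ℝ (Fin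 3)), Adm D → ∀ (n : ℕ) (c : ℝ), 0 < c → ∀ (x : Fin n → EuclideanSpace ℝ (Fin 3)), (∀ i, x i ∈ D) → Function.Injective x → S ((fun z => c • z) '' D) n (fun i => c • x i) = c ^ (-(n : ℝ) * Δ) * S D n x) ∧ (∀ D : Set (EuclideanSpace ℝ (Fin 3)), Adm D → (0 : EuclideanSpace ℝ (Fin 3)) ∉ D → ∀ (n : ℕ) (x : Fin n → EuclideanSpace ℝ (Fin 3)), (∀ i, x i ∈ D) → Function.Injective x → S (ι '' D) n (fun i => ι (x i)) = (∏ i, ‖x i‖ ^ (2 * Δ)) * S D n x)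

/-- item stmt-CriticalPhenomena-4855 · crux · rank 3 · open · by planner
why it might fail: Needs the free lattice surface of EVERY admissible domain (tilted/curved staircases, edges, cusps, null-volume fractal frontiers) to flow to ONE conformally, not merely scale-, invariant 'ordinary' b.c.; scale-invariant b.c. need not be conformal (arXiv:1210.6439 §3); numerics only for balls.
sources: CosmeLopesPenedones2015, arXiv:1210.6439, Cardy1996, arXiv:2407.15914, arXiv:cond-mat/0108418, BurkhardtEisenriegler1995
[crux] MÖBIUS-INVARIANT REMOVAL RATIOS (the restriction signature; ρ-free, Δ-free, existence-free):
for every admissible open D with 0 ∉ D and x ≠ y in D, G^{ιD}_δ(ιx,ιy)/G^{ℝ³}_δ(ιx,ιy) −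
G^D_δ(x,y)/G^{ℝ³}_δ(x,y) → 0 as δ → 0⁺, where G^D_δ is the free-b.c. critical two-point function of
the discretised domain and ι the unit inversion. In the restriction dictionary the ratio is the
defect-weighted avoidance functional E^{xy}[e^{−𝓘(K, Dᶜ)}; K ⊂ D] of the backbone/cluster, a
conformally INVARIANT scalar; with TwoPointDomainTheory it is equivalent to inversion covariance of
H_D. [difficulty: open-problem] -/
@[route_item "route-CriticalPhenomena-MoebiusRestrictionCurrents", crux]
def RemovalRatioInversion : Prop :=
  let Adm : Set (EuclideanSpace ℝ (Fin 3)) → Prop := fun D => IsOpen D ∧ MeasureTheory.volume (frontier D) = 0; let G := fun (D : Set (EuclideanSpace ℝ (Fin 3))) (δ : ℝ) (n : ℕ) (x : Fin n → EuclideanSpace ℝ (Fin 3)) => limUnder Filter.atTop (fun Lb : ℕ => Literature.Probability.LatticeModels.isingExpect (Literature.Probability.LatticeModels.zdGraph 3) ((Literature.Probability.LatticeModels.box 3 Lb).filter (fun z => z ∈ Literature.Probability.LatticeModels.latticeApprox δ '' D)) (Literature.Probability.LatticeModels.criticalBeta 3) 0 Literature.Probability.LatticeModels.BoundaryCondition.free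 (Literature.Probability.LatticeModels.spinMonomial (fun i => Literature.Probability.LatticeModels.latticeApprox δ (x i)))); let ι := EuclideanGeometry.inversion (0 : EuclideanSpace ℝ (Fin 3)) 1; ∀ D : Set (EuclideanSpace ℝ (Fin 3)), Adm D → (0 : EuclideanSpace ℝ (Fin 3)) ∉ D → ∀ (x y : EuclideanSpace ℝ (Fin 3)), x ∈ D → y ∈ D → x ≠ y → Filter.Tendsto (fun δ : ℝ => G (ι '' D) δ 2 ![ι x, ι y] / G Set.univ δ 2 ![ι x, ι y] - G D δ 2 ![x, y] / G Set.univ δ 2 ![x, y]) (nhdsWithin (0 : ℝ) (Set.Ioi 0)) (nhds 0)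

/-- item stmt-CriticalPhenomena-4856 · crux · rank 4 · open · by planner
why it might fail: Contains 'η(3) exists' and O(3) invariance of the full-space two-point limit, both open (arXiv:2208.00864 §8.4 p.29); rigorously only c|x|⁻² ≤ ⟨σ₀σ_x⟩ ≤ C|x|⁻¹ and η ≤ 1/2 IF it exists (arXiv:2404.05700 Thm 1.5); the domain half adds boundary two-point limits for all admissible D, no rigorous tool.
sources: DuminilCopinICM2022, DuminilCopinPanis2025LowerBounds, Literature.Probability.LatticeModels.criticalTwoPoint_bounds, CosmeLopesPenedones2015, ChelkakHonglerIzyurov2021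
[crux] TWO-POINT DOMAIN THEORY (existence half, n = 2): ∃ Δ > 0 and H with ρ₀(δ)²G^D_δ(x,y) →
H_D(x,y) locally uniformly on x ≠ y ∈ D for every admissible open D (canonical ρ₀, so H_{ℝ³}(0,e₁) =
1), H_{ℝ³} > 0 off the diagonal, and covariance of (D,x,y) ↦ H_D(x,y) under translations, O(3) and
dilations (factor c^{-2Δ}). The full-space part is 'η exists, isotropic pure power law' in canonical
units; the domain part is existence of the boundary two-point functions. [difficulty: open-problem] -/
@[route_item "route-CriticalPhenomena-MoebiusRestrictionCurrents", crux]
def TwoPointDomainTheory : Prop :=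
  let Adm : Set (EuclideanSpace ℝ (Fin 3)) → Prop := fun D => IsOpen D ∧ MeasureTheory.volume (frontier D) = 0; let G := fun (D : Set (EuclideanSpace ℝ (Fin 3))) (δ : ℝ) (n : ℕ) (x : Fin n → EuclideanSpace ℝ (Fin 3)) => limUnder Filter.atTop (fun Lb : ℕ => Literature.Probability.LatticeModels.isingExpect (Literature.Probability.LatticeModels.zdGraph 3) ((Literature.Probability.LatticeModels.box 3 Lb).filter (fun z => z ∈ Literature.Probability.LatticeModels.latticeApprox δ '' D)) (Literature.Probability.LatticeModels.criticalBeta 3) 0 Literature.Probability.LatticeModels.BoundaryCondition.free (Literature.Probability.LatticeModels.spinMonomial (fun i => Literature.Probability.LatticeModels.latticeApprox δ (x i)))); let ρ₀ := fun (δ : ℝ) => (Real.sqrt (Literature.Probability.LatticeModels.criticalTwoPoint 3 (Literature.Probability.LatticeModels.latticeApprox δ (EuclideanSpace.single (0 : Fin 3) (1 : ℝ)))))⁻¹; ∃ (Δ : ℝ) (H : Set (EuclideanSpace ℝ (Fin 3)) → EuclideanSpace ℝ (Fin 3) → EuclideanSpace ℝ (Fin 3) → ℝ), 0 < Δ ∧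 (∀ D : Set (EuclideanSpace ℝ (Fin 3)), Adm D → TendstoLocallyUniformlyOn (fun (δ : ℝ) (x : Fin 2 → EuclideanSpace ℝ (Fin 3)) => ρ₀ δ ^ 2 * G D δ 2 x) (fun x => H D (x 0) (x 1)) (nhdsWithin (0 : ℝ) (Set.Ioi 0)) (Literature.Probability.LatticeModels.NonCoincident 3 2 ∩ {x | ∀ i, x i ∈ D})) ∧ (∀ x y : EuclideanSpace ℝ (Fin 3), x ≠ y → 0 < H Set.univ x y) ∧ (∀ D : Set (EuclideanSpace ℝ (Fin 3)), Adm D → ∀ (v x y : EuclideanSpace ℝ (Fin 3)), x ∈ D → y ∈ D → x ≠ y → H ((fun z => z + v) '' D) (x + v) (y + v) = H D x y) ∧ (∀ D : Set (EuclideanSpace ℝ (Fin 3)), Adm D → ∀ (R : EuclideanSpace ℝ (Fin 3) ≃ₗᵢ[ℝ] EuclideanSpace ℝ (Fin 3)) (x y : EuclideanSpace ℝ (Fin 3)), x ∈ D → y ∈ D → x ≠ y → H (R '' D) (R x) (R y) = H D x y) ∧ (∀ D : Set (EuclideanSpace ℝ (Fin 3)), Adm D → ∀ (c : ℝ), 0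 < c → ∀ (x y : EuclideanSpace ℝ (Fin 3)), x ∈ D → y ∈ D → x ≠ y → H ((fun z => c • z) '' D) (c • x) (c • y) = c ^ (-(2 : ℝ) * Δ) * H D x y)

/-- item stmt-CriticalPhenomena-0636 · crux · rank 5 · open · by planner
why it might fail: No lower bound on the intersection (backbone-avoidance) probability of two critical double-current clusters at macroscopic separation on ℤ³ is known; for d ≥ 4 (Aizenman 1982; ADC 2021) and RP long-range α < 3/2 on ℤ³ (Panis 2023) the limit IS Gaussian, so only genuinely n.n. d = 3 input can work.
sources: AizenmanCMP1982, AizenmanDuminilCopinAnnals2021, Panis2023Triviality, Literature.Probability.LatticeModels.ursellFour_eq_doubleCurrent, Literature.Barriers.CriticalPhenomena.IsingTrivialityFromDimensionFour, Literature.Barriers.CriticalPhenomena.LongRangeTrivialityOnZ3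
Crux r4 (non-triviality in d=3): every non-degenerate pointwise scaling limit S of the renormalised
critical Ising correlators on Z^3 has connected four-point function U4 ≢ 0 on non-coincident
configurations. Intended tool: the random-current identity U4(x,y,z,t) =
−2⟨σxσy⟩⟨σzσt⟩·P^{xy,zt}[C_{n1+n2}(x) ∩ C_{n1+n2}(z) ≠ ∅] (Aizenman 1982; ADC2021 arXiv:1912.07973
eq. (3.11)): non-Gaussianity ⇔ the intersection probability of the two double-current clusters at
macroscopic separation does not vanish as δ → 0. Contrast: for d ≥ 4 every such limit IS Gaussian
(Literature.Probability.LatticeModels.highDim_triviality). Its negation refutes the conjunct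
Ising3DConformalLimit itself. -/
@[route_item "route-CriticalPhenomena-MoebiusRestrictionCurrents", crux]
def IsingEuclidUpgradeR4NonGaussian : Prop :=
  ∀ (ρ : ℝ → ℝ) (S : Literature.Probability.LatticeModels.CorrFamily 3), (∀ δ ∈ Set.Ioc (0:ℝ) 1, 0 < ρ δ) → Literature.Probability.LatticeModels.HasPointwiseScalingLimit (Literature.Probability.LatticeModels.criticalCorr 3) ρ S → Literature.Probability.LatticeModels.IsNondegenerateTwoPoint S → Literature.Probability.LatticeModels.HasNontrivialU4 S

/-- item stmt-CriticalPhenomena-4857 · support · rank 9 · closed · proved by Summit.CriticalPhenomena.Ising3DConformalLimit.Theorems.freeIsCritical_proof @ 4b28c05a5d6f (prover) · by planner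
sources: FriedliVelenik2017, AizenmanDuminilCopinSidoravicius2015, Literature.Probability.LatticeModels.hasUniqueGibbsMeasure_criticalBeta_holds
[support] At β_c(3) the free-boundary box limit of every spin monomial exists and equals the
critical (plus-state) correlator: ⟨∏σ_{yᵢ}⟩^free_{box L, β_c} → criticalCorr 3 n y. GKS-II monotone
limit plus uniqueness of the Gibbs measure at β_c(3) (in tree:
hasUniqueGibbsMeasure_criticalBeta_holds, hasBoxLimit_isingCorr_free, exists_freeMeasure_holds).
Used by the assembly to identify the D = ℝ³ member of the domain family with criticalCorr.
[difficulty: provable-now] -/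
@[route_item "route-CriticalPhenomena-MoebiusRestrictionCurrents", crux]
def FreeIsCritical : Prop :=
  ∀ (n : ℕ) (y : Fin n → Literature.Probability.LatticeModels.Site 3), Filter.Tendsto (fun Lb : ℕ => Literature.Probability.LatticeModels.isingExpect (Literature.Probability.LatticeModels.zdGraph 3) (Literature.Probability.LatticeModels.box 3 Lb) (Literature.Probability.LatticeModels.criticalBeta 3) 0 Literature.Probability.LatticeModels.BoundaryCondition.free (Literature.Probability.LatticeModels.spinMonomial y)) Filter.atTop (nhds (Literature.Probability.LatticeModels.criticalCorr 3 n y))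

/-- item stmt-CriticalPhenomena-4858 · support · rank 9 · open · by planner
sources: BurkhardtEisenriegler1995, AizenmanCMP1982, LawlerWerner2004, Cardy1996
[support] LOOP-DEFECT (CASIMIR) FUNCTIONAL IS MÖBIUS INVARIANT (n = 0 level of the restriction
system; the corrected 'loop soup'): for a bounded admissible cavity D with 0 ∉ D̄ and disjoint
closed balls A, B ⊂ D, the interaction free energy 𝓘_δ(D;A,B) = log[Z_D
Z_{D∖(A∪B)}/(Z_{D∖A}Z_{D∖B})] (free b.c., β_c(3); ≥ 0 by GKS-II; all bulk/surface/edge terms cancel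
exactly) satisfies 𝓘_δ(D;A,B) − 𝓘_δ(ιD;ιA,ιB) → 0. Burkhardt–Eisenriegler's hypothesis made a
lattice statement; decay in the separation r of two small balls ∝ r^{-2Δ_ε}, which is what rules out
the Brownian loop measure (∝ r^{-2}) as the defect functional. [difficulty: open-problem] -/
@[route_item "route-CriticalPhenomena-MoebiusRestrictionCurrents"]
def CasimirInversion : Prop :=
  let Adm : Set (EuclideanSpace ℝ (Fin 3)) → Prop := fun D => IsOpen D ∧ MeasureTheory.volume (frontier D) = 0; let Z : Set (EuclideanSpace ℝ (Fin 3)) → ℝ → ℝ := fun D δ => ⨆ Lb : ℕ, Literature.Probability.LatticeModels.isingPartitionFunction (Literature.Probability.LatticeModels.zdGraph 3) ((Literature.Probability.LatticeModels.box 3 Lb).filter (fun z => z ∈ Literature.Probability.LatticeModels.latticeApprox δ '' D)) (Literature.Probability.LatticeModels.criticalBeta 3) 0 Literature.Probability.LatticeModels.BoundaryCondition.free; let I : Set (EuclideanSpace ℝ (Fin 3)) → Set (EuclideanSpace ℝ (Fin 3)) → Set (EuclideanSpace ℝ (Fin 3)) → ℝ → ℝ := fun D A B δ => Real.log (Z D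 δ) + Real.log (Z (D \ (A ∪ B)) δ) - Real.log (Z (D \ A) δ) - Real.log (Z (D \ B) δ); let ι := EuclideanGeometry.inversion (0 : EuclideanSpace ℝ (Fin 3)) 1; ∀ (D : Set (EuclideanSpace ℝ (Fin 3))) (a b : EuclideanSpace ℝ (Fin 3)) (r s : ℝ), Adm D → Bornology.IsBounded D → (0 : EuclideanSpace ℝ (Fin 3)) ∉ closure D → 0 < r → 0 < s → Metric.closedBall a r ⊆ D → Metric.closedBall b s ⊆ D → Disjoint (Metric.closedBall a r) (Metric.closedBall b s) → Filter.Tendsto (fun δ : ℝ => I D (Metric.closedBall a r) (Metric.closedBall b s) δ - I (ι '' D) (ι '' Metric.closedBall a r) (ι '' Metric.closedBall b s) δ) (nhdsWithin (0 : ℝ) (Set.Ioi 0)) (nhds 0)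

/-- item stmt-CriticalPhenomena-4859 · support · rank 9 · closed · proved by Summit.CriticalPhenomena.Ising3DConformalLimit.Theorems.moebiusRestrictionCurrents_cruxesGiveTarget_proof (prover) · by planner
sources: FrancescoMathieuSenechal1997, DuminilCopinICM2022
[support] Glue: TwoPointDomainTheory → RemovalRatioInversion → BackboneLift → Target. From (A) get
Δ, H; RemovalRatioInversion and the convergences give H_{ιD}(ιx,ιy)/H_{ℝ³}(ιx,ιy) =
H_D(x,y)/H_{ℝ³}(x,y); Euclid+scale covariance gives H_{ℝ³}(x,y) = C‖x−y‖^{-2Δ} (reflection taking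
(y−x)/‖y−x‖ to e₁), hence H_{ℝ³}(ιx,ιy) = ‖x‖^{2Δ}‖y‖^{2Δ}H_{ℝ³}(x,y) and inversion covariance of
H_D; feed BackboneLift; positivity of S^{ℝ³}_2 from S_2 = H (plumbing checked in planner
TestGlue.lean). [difficulty: M] -/
@[route_item "route-CriticalPhenomena-MoebiusRestrictionCurrents", crux]
def CruxesGiveTarget : Prop :=
  TwoPointDomainTheory → RemovalRatioInversion → BackboneLift → Target

/-- item stmt-CriticalPhenomena-4860 · support · rank 9 · closed · proved by Summit.CriticalPhenomena.Ising3DConformalLimit.Theorems.moebiusRestrictionCurrents_targetSuffices_proof @ b1634edc3df5 (prover) · by planner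
sources: DuminilCopinICM2022, ChelkakHonglerIzyurov2015
[support] Glue: Target → IsingEuclidUpgradeR4NonGaussian → FreeIsCritical → Ising3DConformalLimit.
Take ρ = ρ₀ (positive on (0,1] by criticalTwoPoint > 0), Δ, S' := S^{ℝ³} extended by 0 off
NonCoincident; FreeIsCritical + surjectivity of latticeApprox δ (δ > 0) turn the D = univ
convergence into HasPointwiseScalingLimit (criticalCorr 3) ρ₀ S'; non-degeneracy from (ii);
Euclid/scale covariance from (iii) with D = univ (images = univ); inversion covariance from (iii)
with D = {0}ᶜ, whose discretisation equals that of univ (latticeApprox δ '' {0}ᶜ = univ), plus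
uniqueness of locally uniform limits; U₄ from the shared crux. [difficulty: M] -/
@[route_item "route-CriticalPhenomena-MoebiusRestrictionCurrents", crux]
def TargetSuffices : Prop :=
  Target → IsingEuclidUpgradeR4NonGaussian → FreeIsCritical → Ising3DConformalLimit

-- item stmt-CriticalPhenomena-5033 · support · rank 9 · open · by planner — informal only, no Lean statement yet:
--   [support] KELVIN COVARIANCE OF THE 3D BROWNIAN BRIDGE-TO-A-POINT (the Δ = 1/2, Gaussian / d ≥ 4
--   instance of the backbone-law invariance behind BackboneLift; provable classical potential theory,
--   informal until the notion lands): for x ≠ y in ℝ³∖{0}, let P_{x→y} be the law of the RANGE (random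
--   compact set) of Brownian motion in ℝ³ started at x and Doob-h-transformed by h = |· − y|⁻¹ (Brownian
--   motion conditioned to hit y, run until the a.s. finite hitting time of y). Then the push-forward of
--   P_{x→y} under the unit inversion ι(z) = z/|z|² is P_{ιx→ιy}; equivalently the un-normalised 3D
--   'excursion'

/-- item stmt-CriticalPhenomena-4861 · assembly · rank 1 · closed · proved by Summit.CriticalPhenomena.Ising3DConformalLimit.Theorems.moebiusRestrictionCurrents_assembly_proof @ ca8760c9235c (prover) · by planner
sources: AizenmanCMP1982, DuminilCopinICM2022
[assembly] TwoPointDomainTheory → RemovalRatioInversion → BackboneLift →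
IsingEuclidUpgradeR4NonGaussian → FreeIsCritical → Ising3DConformalLimit. -/
@[route_item "route-CriticalPhenomena-MoebiusRestrictionCurrents"]
def Assembly : Prop :=
  TwoPointDomainTheory → RemovalRatioInversion → BackboneLift → IsingEuclidUpgradeR4NonGaussian → FreeIsCritical → Ising3DConformalLimit

/-! D-0027 §2.1 — DECIDING THEOREM (planner-authored via `route open/edit --closes-file`; by planner-rbadge-CriticalPhenomena-MoebiusRestri-265d0b2e-g4-0 2026-08-15T16:11:25Z):
its hypotheses are this route's items and its conclusion the sub-problem Statement (glue_lint), and it elaborates with this file. -/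

@[closes "route-CriticalPhenomena-MoebiusRestrictionCurrents"] theorem closes : TwoPointDomainTheory → RemovalRatioInversion → BackboneLift → IsingEuclidUpgradeR4NonGaussian → FreeIsCritical → CruxesGiveTarget → TargetSuffices → _root_.Ising3DConformalLimit :=
  fun hTwoPoint hRemoval hBackbone hNonGaussian hFree hCruxesGiveTarget hTargetSuffices =>
    hTargetSuffices (hCruxesGiveTarget hTwoPoint hRemoval hBackbone) hNonGaussian hFree

end Summit.CriticalPhenomena.Ising3DConformalLimit.Theses.MoebiusRestrictionCurrents
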